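import Mathlib.Analysis.Fourier.FourierTransform
import Mathlib.Analysis.Distribution.SchwartzSpace.Fourier
import Mathlib.Analysis.InnerProductSpace.Adjoint
import Mathlib.MeasureTheory.Measure.Lebesgue.EqHaar
import HarnessLib

/-!
# The Fourier transform under an invertible linear change of variables:
`𝓕(f ∘ A)(ξ) = |det A|⁻¹ 𝓕f((A⁻¹)ᵀ ξ)`; anisotropic (matrix) dilations

Topic `Analysis/Fourier`; namespace `Literature.Analysis.Fourier`.

Grafakos, *Classical Fourier Analysis* (2nd ed. 2008), Prop. 2.2.11 lists the scalar dilation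
(8) `(δᵗf)^ = t⁻ⁿ δ^{1/t} f̂` and the orthogonal change of variables (13) `(f ∘ A)^(ξ) = f̂(Aξ)`
("properties (6)–(8) require a suitable change of variables"); Mathlib has both
(`Real.fourier_comp_linearIsometry`, and the tree's `fourier_comp_smul` in
`Literature/Analysis/Fourier/LpMultiplierDilation.lean`). The common generalisation to an
arbitrary invertible linear map `A` — by the same change of variables `y = Ax`,
`dx = |det A|⁻¹ dy`, `x·ξ = A⁻¹y·ξ = y·(A⁻¹)ᵀξ` — is what ANISOTROPIC scalings need (e.g. the sector
propagators of two-dimensional Fermi systems, Benfatto–Giuliani–Mastropietro 2006, Lemma 2.2 /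
(2.51): a symbol supported on a `γ^h × γ^{h/2}` box has a Fourier transform of size `γ^{3h/2}`
decaying on the dual scales `γ^{-h}`, `γ^{-h/2}`). PROVED here, in a finite-dimensional real inner
product space `V` (so `(A⁻¹)ᵀ` is the adjoint `(A⁻¹)†`):

* `integral_comp_continuousLinearEquiv` — `∫ f(Ax) dx = |det A|⁻¹ ∫ f` for an additive Haar
  measure (Mathlib's `map_linearMap_addHaar_eq_smul_addHaar` + `integral_map_equiv`; the convention
  `∫` of a non-integrable function `= 0` makes it unconditional);
* **`fourier_comp_continuousLinearEquiv`** — `𝓕 (f ∘ A) w = |det A|⁻¹ • 𝓕 f ((A.symm)† w)`;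
* `norm_fourier_comp_continuousLinearEquiv_le` — decay transfer: if `‖𝓕f ξ‖ ≤ C (1 + ‖ξ‖)^{-N}`
  then `‖𝓕(f ∘ A) w‖ ≤ |det A|⁻¹ C (1 + ‖(A.symm)† w‖)^{-N}` (the anisotropic decay: for
  `A = diag(γ^{-h}, γ^{-h/2})`, `|det A|⁻¹ = γ^{3h/2}` and `(A⁻¹)†w = (γ^h w₁, γ^{h/2} w₂)`).

## Mathlib search

`Real.fourier_comp_linearIsometry` (isometries only), `MeasureTheory.Measure.integral_comp_smul`
(scalar dilations), `MeasureTheory.Measure.map_linearMap_addHaar_eq_smul_addHaar`,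
`MeasureTheory.integral_map_equiv`, `ContinuousLinearMap.adjoint_inner_right`; no
`fourier_comp_linearEquiv` (`lean search 'fourier.*[lL]inearEquiv'`: none).

## References

* L. Grafakos, *Classical Fourier Analysis*, 2nd ed., GTM 249 (Springer 2008), Prop. 2.2.11
  (8), (13) and their proof by change of variables, pp. 129–131. [Grafakos2014]
* G. Benfatto, A. Giuliani, V. Mastropietro, Ann. Henri Poincaré 7 (2006) 809–898, §2.5
  Lemma 2.2 (anisotropic sector bounds). [BenfattoGiulianiMastropietro2006]
-/

noncomputable section

open MeasureTheory MeasureTheory.Measure Real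
open scoped FourierTransform InnerProductSpace

namespace Literature.Analysis.Fourier

section Haar

variable {E : Type*} [NormedAddCommGroup E] [NormedSpace ℝ E] [MeasurableSpace E] [BorelSpace E]
  [FiniteDimensional ℝ E] (μ : Measure E) [IsAddHaarMeasure μ]
  {F : Type*} [NormedAddCommGroup F] [NormedSpace ℝ F]

/-- **Linear change of variables under an additive Haar measure**: `∫ f(Ax) dμ = |det A|⁻¹ ∫ f dμ`
for a continuous linear automorphism `A` (unconditional, with the convention that non-integrable
functions integrate to `0`). Grafakos 2008, proof of Prop. 2.2.11 ("change of variables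
`y = Ax`"). [cite: Grafakos2014, Prop. 2.2.11] -/
theorem integral_comp_continuousLinearEquiv (A : E ≃L[ℝ] E) (f : E → F) :
    ∫ x, f (A x) ∂μ = |(LinearMap.det (A : E →ₗ[ℝ] E))⁻¹| • ∫ x, f x ∂μ := by
  have hdet : LinearMap.det (A : E →ₗ[ℝ] E) ≠ 0 := by
    rw [← LinearEquiv.coe_det]
    exact (LinearEquiv.det (A : E ≃ₗ[ℝ] E)).ne_zero
  calc ∫ x, f (A x) ∂μ = ∫ y, f y ∂(Measure.map A μ) :=
        (integral_map_equiv A.toHomeomorph.toMeasurableEquiv f).symm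
    _ = |(LinearMap.det (A : E →ₗ[ℝ] E))⁻¹| • ∫ x, f x ∂μ := by
        have hmap : Measure.map (A : E → E) μ =
            ENNReal.ofReal |(LinearMap.det (A : E →ₗ[ℝ] E))⁻¹| • μ :=
          map_linearMap_addHaar_eq_smul_addHaar μ hdet
        rw [hmap, integral_smul_measure, ENNReal.toReal_ofReal (abs_nonneg _)]

end Haar

section Fourier

variable {V : Type*} [NormedAddCommGroup V] [InnerProductSpace ℝ V] [FiniteDimensional ℝ V]
  [MeasurableSpace V] [BorelSpace V]
  {E : Type*} [NormedAddCommGroup E] [NormedSpace ℂ E]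

/-- **The Fourier transform under an invertible linear change of variables**:
`𝓕 (f ∘ A) w = |det A|⁻¹ • 𝓕 f ((A⁻¹)† w)` — the common generalisation of the dilation rule (8)
and the orthogonal rule (13) of Grafakos 2008, Prop. 2.2.11 (`(A⁻¹)†` = the inverse transpose).
[cite: Grafakos2014, Prop. 2.2.11 (8), (13)] -/
theorem fourier_comp_continuousLinearEquiv (A : V ≃L[ℝ] V) (f : V → E) (w : V) :
    𝓕 (f ∘ A) w =
      |(LinearMap.det (A : V →ₗ[ℝ] V))⁻¹| •
        𝓕 f (ContinuousLinearMap.adjoint (A.symm : V →L[ℝ] V) w) := by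
  rw [Real.fourier_eq, Real.fourier_eq]
  -- rewrite the integrand as `g (A v)` with `g u = 𝐞(-⟪u, (A⁻¹)† w⟫) • f u`
  have h : (fun v : V => (𝐞 (-⟪v, w⟫_ℝ) : Circle) • f (A v)) =
      fun v => (fun u : V => (𝐞 (-⟪u, ContinuousLinearMap.adjoint (A.symm : V →L[ℝ] V) w⟫_ℝ) : Circle) • f u)
        (A v) := by
    funext v
    simp only [ContinuousLinearMap.adjoint_inner_right, ContinuousLinearEquiv.coe_coe,
      ContinuousLinearEquiv.symm_apply_apply]
  simp only [Function.comp_apply]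
  rw [h]
  exact integral_comp_continuousLinearEquiv volume A
    (fun u : V => (𝐞 (-⟪u, ContinuousLinearMap.adjoint (A.symm : V →L[ℝ] V) w⟫_ℝ) : Circle) • f u)

/-- **Decay transfer under an anisotropic change of variables**: if `‖𝓕f ξ‖ ≤ C(1 + ‖ξ‖)^{-N}`
for all `ξ` then `‖𝓕(f ∘ A) w‖ ≤ |det A|⁻¹ C (1 + ‖(A⁻¹)† w‖)^{-N}` for all `w` (the form of
BGM 2006 Lemma 2.2 / (2.51): volume factor `|det A|⁻¹ = γ^{3h/2}` and decay on the dual scales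
for `A = diag(γ^{-h}, γ^{-h/2})`). [cite: BenfattoGiulianiMastropietro2006, §2.5 Lemma 2.2] -/
theorem norm_fourier_comp_continuousLinearEquiv_le (A : V ≃L[ℝ] V) {f : V → E} {C : ℝ} {N : ℕ}
    (hf : ∀ ξ, ‖𝓕 f ξ‖ ≤ C * ((1 + ‖ξ‖) ^ N)⁻¹) (w : V) :
    ‖𝓕 (f ∘ A) w‖ ≤
      |(LinearMap.det (A : V →ₗ[ℝ] V))⁻¹| *
        (C * ((1 + ‖ContinuousLinearMap.adjoint (A.symm : V →L[ℝ] V) w‖) ^ N)⁻¹) := by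
  rw [fourier_comp_continuousLinearEquiv, norm_smul, Real.norm_eq_abs, abs_abs]
  exact mul_le_mul_of_nonneg_left (hf _) (abs_nonneg _)

end Fourier

/-! ### Schwartz symbols: every-order anisotropic decay -/

section Schwartz

variable {V : Type*} [NormedAddCommGroup V] [InnerProductSpace ℝ V] [FiniteDimensional ℝ V]
  [MeasurableSpace V] [BorelSpace V]
  {E : Type*} [NormedAddCommGroup E] [NormedSpace ℂ E]

omit [InnerProductSpace ℝ V] [FiniteDimensional ℝ V] [MeasurableSpace V] [BorelSpace V] in
/-- A Schwartz function decays to every polynomial order: `‖g x‖ ≤ C_N (1 + ‖x‖)^{-N}`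
(Mathlib's `SchwartzMap.one_add_le_sup_seminorm_apply` with no derivatives). [folklore] -/
theorem schwartz_norm_le_inv_pow {W : Type*} [NormedAddCommGroup W] [NormedSpace ℝ W]
    (g : SchwartzMap W E) (N : ℕ) :
    ∃ C : ℝ, 0 ≤ C ∧ ∀ x, ‖g x‖ ≤ C * ((1 + ‖x‖) ^ N)⁻¹ := by
  refine ⟨2 ^ N * (Finset.Iic (N, 0)).sup (fun m => SchwartzMap.seminorm ℂ m.1 m.2) g, by positivity,
    fun x => ?_⟩
  have h := SchwartzMap.one_add_le_sup_seminorm_apply (𝕜 := ℂ) (m := (N, 0)) le_rfl le_rfl g x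
  rw [norm_iteratedFDeriv_zero] at h
  have hpos : 0 < (1 + ‖x‖) ^ N := by positivity
  rw [← div_eq_mul_inv, le_div_iff₀ hpos, mul_comm]
  exact h

/-- **Anisotropic decay of the Fourier transform of a rescaled Schwartz symbol**: for
`φ ∈ 𝓢(V)` and an invertible linear `A`, for every `N` there is `C_N` (depending on `φ`, `N`
only) with `‖𝓕(φ ∘ A) w‖ ≤ |det A|⁻¹ C_N (1 + ‖(A⁻¹)† w‖)^{-N}` for all `w` — the shape of
BGM 2006 Lemma 2.2 / (2.51) (for `A = diag(γ^{-h}, γ^{-h/2})`: size `γ^{3h/2}`, decay on the scales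
`γ^{-h}` and `γ^{-h/2}` in the two directions), here in the continuum and for a fixed smooth symbol.
[cite: BenfattoGiulianiMastropietro2006, §2.5 Lemma 2.2] -/
theorem exists_norm_fourier_schwartz_comp_le (φ : SchwartzMap V E) (A : V ≃L[ℝ] V) (N : ℕ) :
    ∃ C : ℝ, 0 ≤ C ∧ ∀ w,
      ‖𝓕 ((φ : V → E) ∘ A) w‖ ≤
        |(LinearMap.det (A : V →ₗ[ℝ] V))⁻¹| *
          (C * ((1 + ‖ContinuousLinearMap.adjoint (A.symm : V →L[ℝ] V) w‖) ^ N)⁻¹) := by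
  obtain ⟨C, hC0, hC⟩ := schwartz_norm_le_inv_pow (𝓕 φ) N
  refine ⟨C, hC0, fun w => norm_fourier_comp_continuousLinearEquiv_le A (fun ξ => ?_) w⟩
  have := hC ξ
  rwa [SchwartzMap.fourier_coe] at this

end Schwartz

end Literature.Analysis.Fourier

end
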